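import Literature.Computability.Complexity.CircuitComposition
import Summits.PneNP.PneNP.Theorems.CliqueExtLowerBound.Negative.PermConsequences
import Summits.PneNP.PneNP.Theorems.ConvexRankGatesCaptureDefs
import Mathlib.Analysis.Fourier.FiniteAbelian.PontryaginDuality
import Mathlib.Analysis.SpecialFunctions.Complex.CircleAddChar
import Mathlib.LinearAlgebra.Matrix.Notation
import Mathlib.Algebra.Group.Fin.Tuple
import HarnessLib

-- progress log (stub worker S2, 2026-08-16): v1 complete — duality over ℤ/m via complex
-- characters, Fredholm alternative, OR of PERM gates; `lean check` rc 0, no warnings, 0 sorries,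
-- axioms {propext, Classical.choice, Quot.sound}; proposing --supports stmt-PneNP-2659.

/-!
# Route ConvexRankGates, crux `Capture` (stmt-PneNP-2659), line `csp-spine-meet-to-join`:
# Stub 2 `stub_cyclicFredholm` — LIN gates over `ℤ/m` are poly-size `{∧₂,∨₂,1,0} ∪ PERM` circuits

Registered stub `stub_cyclicFredholm` of the skeleton
`Summits/PneNP/PneNP/Cruxes/Capture/Lines/csp-spine-meet-to-join.lean`, in the vocabulary of
`Theorems/ConvexRankGatesCaptureDefs.lean` (`IsLinGate`, `permBasis`, `monConst`): a LIN gate of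
size parameter `s` — modulus `0 < m ≤ s`, dimension `D ≤ s`, one affine equation
`a j ⬝ᵥ y = b j` over `ZMod m` per input wire `j`, firing iff the SELECTED system is unsolvable —
is computed by a circuit over `permBasis ((s+2)^2) = {∧₂, ∨₂, 1, 0} ∪ PERM_{(s+2)^2}` with at
most `(s+2)^2` gates.

Proof ("Fredholm alternative = meet-to-join", directly over the cyclic ring `ℤ/m`, no CRT):
* `lin_addChar_eq_dotProduct`: every complex character of `(ℤ/m)^k` is a dot-product character
  `y ↦ e(u ⬝ᵥ y)` (`AddChar.zmodAddEquiv` coordinatewise), hence (`lin_exists_dotProduct_ne_zero`,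
  from `AddChar.exists_apply_ne_zero` on the quotient) a subgroup `N ≤ (ℤ/m)^k` equals its double
  orthogonal: `x ∉ N ⇒ ∃ u ⊥ N, u ⬝ᵥ x ≠ 0`.
* `lin_unsat_iff` (Fredholm alternative over `ℤ/m`): with `N` the subgroup of `(ℤ/m)^{D+1}`
  generated by the selected augmented rows `(b j, a j)`, the selected system is unsolvable iff
  `(c, 0, …, 0) ∈ N` for some `c ≠ 0`. (A solution `y` makes `(-1, y)` orthogonal to `N` but
  not to `(c, 0, …, 0)`; conversely the last coordinates of `N^⊥` form a subgroup `J ≤ ℤ/m`,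
  solvable iff `-1 ∈ J`, and a proper `J` is killed by `c := |J| ≠ 0`, so `(c,0,…,0) ∈ N^⊥⊥ = N`.)
* one PERM gate per candidate `c ≠ 0` (`abelianProgram_isPermGate`: the translation action of
  `(ℤ/m)^{D+1}` on `ℤ/m × Fin (D+1)`, width `m (D+1) ≤ (s+2)^2`), OR-ed by a chain of `∨₂` gates
  seeded with the constant `0` (`lin_cktSize_exists`): `≤ 1 + 2m ≤ (s+2)^2` gates. For `m = 1`
  the chain is the single gate `0`, as it must be (`ZMod 1` is trivial, every system solvable).

The PERM width is polynomial in `m`, not in `log m`, consistent with Disproof §3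
(`no_zmod_two_pow_embedding`). Sources: the line card
`Cruxes/Capture/Lines/csp-spine-meet-to-join.md`; M. Göös, P. Kamath, R. Robere, D. Sokolov,
*Adventures in monotone complexity and TFNP*, ITCS 2019, §1 (the `m = 2` case, landed as
`Theorems/ConvexRankGatesXorUnsatIsOnePermGate.lean`); Pontryagin duality for finite abelian
groups (Mathlib `Mathlib.Analysis.Fourier.FiniteAbelian.PontryaginDuality`).
-/

namespace Summit.PneNP.PneNP.Cruxes.Capture.CspSpineMeetToJoin

set_option linter.dupNamespace false -- `Summit.PneNP.PneNP.…`: summit = sub-problem (D-0017)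

open scoped Matrix
open Literature.Computability.Complexity
open Summit.PneNP.PneNP.Theorems.CliqueExtLowerBound.Negative (abelianProgram_isPermGate)

/-! ## Duality over `ℤ/m`: characters of `(ℤ/m)^k` are dot products -/

/-- Every complex character of `Fin k → ZMod m` is a dot-product character
`y ↦ stdAddChar (u ⬝ᵥ y)`: coordinatewise it is a character of `ZMod m`, i.e. `t ↦ e(c t / m)`
(`AddChar.zmodAddEquiv`), and `y = ∑ i, Pi.single i (y i)`. -/
private theorem lin_addChar_eq_dotProduct {m k : ℕ} [NeZero m]
    (φ : AddChar (Fin k → ZMod m) ℂ) :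
    ∃ u : Fin k → ZMod m, ∀ y, φ y = ZMod.stdAddChar (u ⬝ᵥ y) := by
  have hc : ∀ i, ∃ c : ZMod m, ∀ t, φ (Pi.single i t) = ZMod.stdAddChar (c * t) := fun i => by
    obtain ⟨c, hc⟩ := (AddChar.zmodAddEquiv (n := m)).surjective
      (φ.compAddMonoidHom (AddMonoidHom.single (fun _ : Fin k => ZMod m) i))
    exact ⟨c, fun t => (DFunLike.congr_fun hc t).symm⟩
  choose u hu using hc
  refine ⟨u, fun y => Pi.single_induction (fun y => φ y = ZMod.stdAddChar (u ⬝ᵥ y)) y ?_ ?_ ?_⟩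
  · simp
  · intro f g hf hg
    rw [AddChar.map_add_eq_mul, hf, hg, dotProduct_add, AddChar.map_add_eq_mul]
  · intro i t
    rw [hu, dotProduct_single]

/-- **`N = N^⊥⊥` over `ℤ/m`.** If `x ∉ N` for a subgroup `N ≤ (Fin k → ZMod m)`, some vector `u`
orthogonal to `N` (for the dot product) is not orthogonal to `x`: a complex character of the
finite abelian group `(Fin k → ZMod m) ⧸ N` that is nontrivial at `[x]`
(`AddChar.exists_apply_ne_zero`) is a dot-product character `e(u ⬝ᵥ ·)`. -/
private theorem lin_exists_dotProduct_ne_zero {m k : ℕ} [NeZero m]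
    (N : AddSubgroup (Fin k → ZMod m)) {x : Fin k → ZMod m} (hx : x ∉ N) :
    ∃ u : Fin k → ZMod m, (∀ w ∈ N, u ⬝ᵥ w = 0) ∧ u ⬝ᵥ x ≠ 0 := by
  have hx' : (x : (Fin k → ZMod m) ⧸ N) ≠ 0 := mt (QuotientAddGroup.eq_zero_iff x).1 hx
  obtain ⟨ψ, hψ⟩ := AddChar.exists_apply_ne_zero.2 hx'
  obtain ⟨u, hu⟩ := lin_addChar_eq_dotProduct (ψ.compAddMonoidHom (QuotientAddGroup.mk' N))
  refine ⟨u, fun w hw => ZMod.injective_stdAddChar ?_, fun h0 => hψ ?_⟩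
  · rw [← hu, AddChar.map_zero_eq_one, AddChar.compAddMonoidHom_apply,
      QuotientAddGroup.mk'_apply, (QuotientAddGroup.eq_zero_iff w).2 hw, AddChar.map_zero_eq_one]
  · rw [← QuotientAddGroup.mk'_apply, ← AddChar.compAddMonoidHom_apply, hu, h0,
      AddChar.map_zero_eq_one]

/-- A proper additive subgroup `J` of `ZMod m` is killed by a nonzero element, namely
`c := |J|` (`|J| • j = 0`, and `|J|` is a proper divisor of `m`). -/
private theorem lin_exists_ne_zero_mul_eq_zero {m : ℕ} [NeZero m] (J : AddSubgroup (ZMod m))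
    (hJ : J ≠ ⊤) : ∃ c : ZMod m, c ≠ 0 ∧ ∀ j ∈ J, c * j = 0 := by
  refine ⟨Nat.card J, fun h => hJ ?_, fun j hj => ?_⟩
  · rw [ZMod.natCast_eq_zero_iff] at h
    refine AddSubgroup.eq_top_of_card_eq J ?_
    rw [Nat.card_zmod]
    exact Nat.dvd_antisymm (by simpa only [Nat.card_zmod] using J.card_addSubgroup_dvd_card) h
  · rw [← nsmul_eq_mul]
    exact congrArg Subtype.val (card_nsmul_eq_zero' (x := (⟨j, hj⟩ : J)))

/-! ## The Fredholm alternative over `ℤ/m` -/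

section Fredholm

variable {m D n : ℕ}

/-- Easy direction: if `y` solves the selected equations then every element `w` of the subgroup
generated by the selected augmented rows `(b j, a j)` satisfies `w ⬝ᵥ (-1, y) = 0`, which
`(c, 0, …, 0)` with `c ≠ 0` does not. -/
private theorem lin_unsat_of_mem (a : Fin n → Fin D → ZMod m) (b : Fin n → ZMod m)
    (T : Set (Fin n)) {c : ZMod m} (hc : c ≠ 0)
    (hcN : Matrix.vecCons c 0 ∈
      AddSubgroup.closure ((fun j => Matrix.vecCons (b j) (a j)) '' T)) :
    ¬ ∃ y : Fin D → ZMod m, ∀ j ∈ T, a j ⬝ᵥ y = b j := by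
  rintro ⟨y, hy⟩
  have key : ∀ w ∈ AddSubgroup.closure ((fun j => Matrix.vecCons (b j) (a j)) '' T),
      w ⬝ᵥ Matrix.vecCons (-1) y = 0 := by
    intro w hw
    induction hw using AddSubgroup.closure_induction with
    | mem w hw =>
      obtain ⟨j, hj, rfl⟩ := hw
      rw [Matrix.cons_dotProduct_cons, hy j hj, mul_neg_one, neg_add_cancel]
    | zero => exact zero_dotProduct _
    | add u w _ _ hu hw => rw [add_dotProduct, hu, hw, add_zero]
    | neg u _ hu => rw [neg_dotProduct, hu, neg_zero]
  have h := key _ hcN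
  rw [Matrix.cons_dotProduct_cons, zero_dotProduct, add_zero, mul_neg_one, neg_eq_zero] at h
  exact hc h

variable [NeZero m]

/-- Hard direction: if no nonzero `(c, 0, …, 0)` lies in the subgroup `N` generated by the
selected augmented rows, the selected system is solvable. The last coordinates of the vectors
orthogonal to `N` form a subgroup `J ≤ ZMod m`; if `-1 ∈ J` we read off a solution, otherwise a
nonzero `c` killing `J` (`lin_exists_ne_zero_mul_eq_zero`) puts `(c, 0, …, 0)` in `N^⊥⊥ = N`
(`lin_exists_dotProduct_ne_zero`). -/
private theorem lin_sat_of_forall (a : Fin n → Fin D → ZMod m) (b : Fin n → ZMod m)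
    (T : Set (Fin n))
    (H : ∀ c : ZMod m, Matrix.vecCons c 0 ∈
      AddSubgroup.closure ((fun j => Matrix.vecCons (b j) (a j)) '' T) → c = 0) :
    ∃ y : Fin D → ZMod m, ∀ j ∈ T, a j ⬝ᵥ y = b j := by
  set N := AddSubgroup.closure ((fun j => Matrix.vecCons (b j) (a j)) '' T) with hN
  -- the subgroup `J = {u 0 | u ∈ N^⊥}` of `ZMod m`
  let J : AddSubgroup (ZMod m) :=
    { carrier := {c | ∃ u : Fin (D + 1) → ZMod m, (∀ w ∈ N, u ⬝ᵥ w = 0) ∧ u 0 = c}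
      zero_mem' := ⟨0, fun w _ => zero_dotProduct w, rfl⟩
      add_mem' := by
        rintro _ _ ⟨u, hu, rfl⟩ ⟨u', hu', rfl⟩
        exact ⟨u + u', fun w hw => by rw [add_dotProduct, hu w hw, hu' w hw, add_zero], rfl⟩
      neg_mem' := by
        rintro _ ⟨u, hu, rfl⟩
        exact ⟨-u, fun w hw => by rw [neg_dotProduct, hu w hw, neg_zero], rfl⟩ }
  by_cases hJ : J = ⊤
  · -- `-1 ∈ J`: read off a solution
    have h1 : (-1 : ZMod m) ∈ J := hJ ▸ AddSubgroup.mem_top _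
    obtain ⟨u, hu, hu0⟩ := h1
    refine ⟨Matrix.vecTail u, fun j hj => ?_⟩
    have h := hu _ (AddSubgroup.subset_closure ⟨j, hj, rfl⟩)
    rw [Matrix.dotProduct_cons, Matrix.vecHead, hu0, neg_one_mul, neg_add_eq_zero] at h
    rw [dotProduct_comm]
    exact h.symm
  · -- a nonzero `c` killing `J` gives `(c, 0, …, 0) ∈ N^⊥⊥ = N`: contradiction
    exfalso
    obtain ⟨c, hc, hcJ⟩ := lin_exists_ne_zero_mul_eq_zero J hJ
    refine hc (H c ?_)
    by_contra hcN
    obtain ⟨u, huN, hux⟩ := lin_exists_dotProduct_ne_zero N hcN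
    refine hux ?_
    rw [Matrix.dotProduct_cons, dotProduct_zero, add_zero, mul_comm]
    exact hcJ _ ⟨u, huN, rfl⟩

/-- **Fredholm alternative over `ℤ/m`.** The selected affine system `a j ⬝ᵥ y = b j` (`j ∈ T`)
over `ZMod m` is unsolvable iff `(c, 0, …, 0)` lies in the subgroup of `(ZMod m)^{D+1}` generated
by the selected augmented rows `(b j, a j)` for some `c ≠ 0`. -/
private theorem lin_unsat_iff (a : Fin n → Fin D → ZMod m) (b : Fin n → ZMod m)
    (T : Set (Fin n)) :
    (¬ ∃ y : Fin D → ZMod m, ∀ j ∈ T, a j ⬝ᵥ y = b j) ↔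
      ∃ c : ZMod m, c ≠ 0 ∧ Matrix.vecCons c 0 ∈
        AddSubgroup.closure ((fun j => Matrix.vecCons (b j) (a j)) '' T) := by
  refine ⟨fun h => ?_, fun ⟨c, hc, hcN⟩ => lin_unsat_of_mem a b T hc hcN⟩
  by_contra hno
  simp only [not_exists, not_and] at hno
  exact h (lin_sat_of_forall a b T fun c hcN => by_contra fun hc => hno c hc hcN)

end Fredholm

/-! ## The circuit: an `∨` of PERM gates -/

/-- Additive rewording of the acceptance condition of `abelianProgram_isPermGate`. -/
private theorem lin_ofAdd_mem_closure_iff {A : Type*} [AddCommGroup A] {n : ℕ} (ρ : Fin n → A)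
    (t : A) (S : Set (Fin n)) :
    Multiplicative.ofAdd t ∈ Subgroup.closure ((fun j => Multiplicative.ofAdd (ρ j)) '' S) ↔
      t ∈ AddSubgroup.closure (ρ '' S) := by
  rw [← Set.image_image Multiplicative.ofAdd ρ S, Equiv.image_eq_preimage_symm,
    Multiplicative.ofAdd_symm_eq, ← AddSubgroup.toSubgroup_closure, Multiplicative.mem_toSubgroup,
    toAdd_ofAdd]

/-- OR of a list of single-output programs over a basis containing `∨₂` and the constant `0`:
`1 + |l| (s + 1)` gates (the empty OR is the constant `0`). -/
private theorem lin_cktSize_exists {ι α : Type*} {B : Set GateFn} (hor : GateFn.or 2 ∈ B)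
    (h0 : GateFn.const false ∈ B) (P : α → (ι → Bool) → Bool) {s : ℕ}
    (hP : ∀ a, CktSize B (fun x (_ : Unit) => P a x) s) :
    ∀ l : List α,
      CktSize B (fun x (_ : Unit) => decide (∃ a ∈ l, P a x = true)) (1 + l.length * (s + 1))
  | [] => by
    refine ((CktSize.gate (GateFn.const false) h0 (Fin.elim0 : Fin 0 → ι)).congr
      fun x _ => ?_).of_le (by simp)
    simp [GateFn.const]
  | a :: l => by
    have h2 := ((hP a).pair (lin_cktSize_exists hor h0 P hP l)).comp
      (CktSize.gate (GateFn.or 2) hor (![Sum.inl (), Sum.inr ()] : Fin 2 → Unit ⊕ Unit))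
    refine (h2.congr fun x _ => ?_).of_le ?_
    · rw [Bool.eq_iff_iff]
      simp [GateFn.or, Fin.exists_fin_two]
    · rw [List.length_cons, add_one_mul]
      omega

/-- **The circuit for one LIN gate.** For rows `a`, right-hand sides `b` over `ZMod m` and any
`S ≥ m (D + 1)`: a circuit over `permBasis S` with `≤ 1 + 2m` gates firing on the selection `x`
iff the selected system is unsolvable — the `∨` over `c ≠ 0` of the PERM gates
"`(c, 0, …, 0) ∈ ⟨(b j, a j) : x j = 1⟩`" (`abelianProgram_isPermGate`, `lin_unsat_iff`). -/
private theorem lin_circuit {m D n : ℕ} [NeZero m] (a : Fin n → Fin D → ZMod m)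
    (b : Fin n → ZMod m) {S : ℕ} (hS : m * (D + 1) ≤ S) :
    ∃ C : Circuit (Fin n), C.IsOver (permBasis S) ∧ C.size ≤ 1 + m * 2 ∧
      ∀ x, C.eval x = true ↔ ¬ ∃ y : Fin D → ZMod m, ∀ j, x j = true → a j ⬝ᵥ y = b j := by
  classical
  -- one PERM gate per candidate `c`
  let P : ZMod m → (Fin n → Bool) → Bool := fun c v =>
    decide (Multiplicative.ofAdd (Matrix.vecCons c (0 : Fin D → ZMod m)) ∈ Subgroup.closure
      ((fun j => Multiplicative.ofAdd (Matrix.vecCons (b j) (a j))) '' {j | v j = true}))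
  have hPB : ∀ c, (⟨n, P c⟩ : GateFn) ∈ permBasis S := fun c => by
    refine Or.inr ((abelianProgram_isPermGate (fun j => Matrix.vecCons (b j) (a j))
      (Matrix.vecCons c 0) (P c) fun v => decide_eq_true_iff).mono ?_)
    rwa [Fintype.card_prod, ZMod.card, Fintype.card_fin]
  have hor : GateFn.or 2 ∈ permBasis S := by simp [permBasis, monConst]
  have h0 : GateFn.const false ∈ permBasis S := by simp [permBasis, monConst]
  set l : List (ZMod m) := (Finset.univ.filter fun c : ZMod m => c ≠ 0).toList with hl
  have hlen : l.length ≤ m := by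
    rw [hl, Finset.length_toList]
    exact (Finset.card_filter_le _ _).trans (by rw [Finset.card_univ, ZMod.card])
  have hsize := lin_cktSize_exists hor h0 P
    (fun c => (CktSize.gate (B := permBasis S) ⟨n, P c⟩ (hPB c) id).congr fun _ _ => rfl) l
  obtain ⟨C, hCB, hCs, hCe⟩ := hsize.toCircuit
  refine ⟨C, hCB, hCs.trans (by omega), fun x => ?_⟩
  rw [hCe]
  refine Iff.trans ?_ (lin_unsat_iff a b {j | x j = true}).symm
  simp [hl, P, lin_ofAdd_mem_closure_iff]

/-- **Stub 2 `stub_cyclicFredholm` (`CyclicFredholm`).** A LIN gate of size parameter `s`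
(modulus `0 < m ≤ s`, dimension `D ≤ s`, one affine equation over `ZMod m` per input, firing
iff the selected system is unsolvable) is computed by a circuit over
`permBasis ((s+2)^2) = {∧₂, ∨₂, 1, 0} ∪ PERM_{(s+2)^2}` with at most `(s+2)^2` gates: the `∨`
over the `m - 1 ≤ s` candidates `c ≠ 0` of ONE PERM gate of width `m (D+1) ≤ (s+2)^2` each,
correct by the Fredholm alternative over `ℤ/m` (`lin_unsat_iff`). -/
theorem stub_cyclicFredholm : ∃ c : ℕ, ∀ (s : ℕ) (g : GateFn), IsLinGate s g → ∃ C : Circuit (Fin g.1), C.IsOver (permBasis ((s + 2) ^ c)) ∧ C.size ≤ (s + 2) ^ c ∧ C.Computes g.2 := by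
  refine ⟨2, fun s g hg => ?_⟩
  obtain ⟨m, D, hm, hms, hDs, a, b, hiff⟩ := hg
  haveI : NeZero m := ⟨hm.ne'⟩
  have hmul : m * (D + 1) ≤ s * (s + 1) := Nat.mul_le_mul hms (Nat.succ_le_succ hDs)
  obtain ⟨C, hCB, hCs, hCe⟩ := lin_circuit a b (S := (s + 2) ^ 2) (by nlinarith)
  refine ⟨C, hCB, hCs.trans (by nlinarith), fun x => ?_⟩
  rw [Bool.eq_iff_iff, hCe x, hiff x]

end Summit.PneNP.PneNP.Cruxes.Capture.CspSpineMeetToJoin
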